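import Summits.CriticalPhenomena.Ising3DConformalLimit.Theorems.PrecisionLaplacianDirectCorrelationStableTailConverseSpine
import HarnessLib

/-!
# Crux `PrecisionLaplacian.DirectCorrelationStableTail` (stmt-CriticalPhenomena-4799) — the hypothesis-free logical map

Continuation lead prover-line-stmt-CriticalPhenomena-4799-c5-0 (2026-08-17), line `diffusive-branch-is-nonsaturation`
(complete: all registered stubs landed by leads c2–c4).  Pure theorem file, bookkeeping only.

The landed converse two-point spine (`…ConverseSpine.lean`, `…ConverseSpineModulo.lean`) states its equivalences UNDER the
crux's antecedent `H` (every finite critical kernel matrix is a symmetric potential) as an extra hypothesis.  Since the crux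
is itself the implication `H → TAIL`, the hypothesis can be absorbed, which gives the three hypothesis-free statements a
planner needs to read the item off the ledger:

* `directCorrelationStableTail_iff_symmPotential_imp` : crux ↔ (H → item 0634 ∧ item 1342);
* `directCorrelationStableTail_iff_symmPotential_imp_twoPointLaw_gt_half` : crux ↔ (H → isotropic pure power law with `Δ > 1/2`);
* `DirectCorrelationStableTail_of_twoPointLaw_gt_half` : (isotropic pure power law with some `Δ > 1/2`) → crux, outright.

Reading: the truth value of the item is `(¬H) ∨ (0634 ∧ 1342)`; item 0634 (`IsingEuclidUpgradeR2RotInvPowerLaw`, open) with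
its exponent witness decides it given `H`.
-/

noncomputable section

namespace Summit.CriticalPhenomena.Ising3DConformalLimit.Cruxes.DirectCorrelationStableTail.DiffusiveBranchIsNonsaturation

open Filter Topology
open scoped BigOperators
open Literature.Probability.LatticeModels
open Summit.CriticalPhenomena.Ising3DConformalLimit.Theses

/-- **Hypothesis-free logical map.**  The crux `DirectCorrelationStableTail` is EQUIVALENT to the implication
"`H` (every finite critical kernel matrix is a symmetric potential) ⇒ item 0634 (isotropic pure power law of the critical
two-point function) ∧ item 1342 (NonSaturation)". -/
theorem directCorrelationStableTail_iff_symmPotential_imp :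
    PrecisionLaplacian.DirectCorrelationStableTail ↔
      ((∀ A : Finset (Site 3), (Matrix.of fun (p q : ↥A) => criticalTwoPoint 3 (q.1 - p.1)).PosDef ∧
        ∀ u v : ↥A, (u ≠ v → (Matrix.of fun (p q : ↥A) => criticalTwoPoint 3 (q.1 - p.1))⁻¹ u v ≤ 0) ∧
          0 ≤ ∑ w, (Matrix.of fun (p q : ↥A) => criticalTwoPoint 3 (q.1 - p.1))⁻¹ u w) →
      IsingEuclidUpgrade.IsingEuclidUpgradeR2RotInvPowerLaw ∧ PerfectScreening.NonSaturation) := by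
  constructor
  · intro hT hH
    exact (directCorrelationStableTail_iff_twoPointLaw_and_nonSaturation_of_levyContinuity
      stub_levyContinuityTransfer hH).1 hT
  · intro h
    unfold PrecisionLaplacian.DirectCorrelationStableTail
    intro hH
    exact (directCorrelationStableTail_iff_twoPointLaw_and_nonSaturation_of_levyContinuity
      stub_levyContinuityTransfer hH).2 (h hH) hH

/-- **Hypothesis-free one-item form.**  The crux is EQUIVALENT to "`H` ⇒ the critical two-point function obeys an isotropic
pure power law `G(x)|x|₂^{2Δ} → c > 0` with SOME exponent `Δ > 1/2`" (item 0634's conclusion with its `Δ`-witness above `1/2`). -/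
theorem directCorrelationStableTail_iff_symmPotential_imp_twoPointLaw_gt_half :
    PrecisionLaplacian.DirectCorrelationStableTail ↔
      ((∀ A : Finset (Site 3), (Matrix.of fun (p q : ↥A) => criticalTwoPoint 3 (q.1 - p.1)).PosDef ∧
        ∀ u v : ↥A, (u ≠ v → (Matrix.of fun (p q : ↥A) => criticalTwoPoint 3 (q.1 - p.1))⁻¹ u v ≤ 0) ∧
          0 ≤ ∑ w, (Matrix.of fun (p q : ↥A) => criticalTwoPoint 3 (q.1 - p.1))⁻¹ u w) →
      ∃ Δ c : ℝ, 1 / 2 < Δ ∧ 0 < c ∧ Filter.Tendsto (fun x : Site 3 => criticalTwoPoint 3 x *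
        Real.sqrt (∑ i, ((x i : ℝ)) ^ 2) ^ (2 * Δ)) Filter.cofinite (nhds c)) := by
  constructor
  · intro hT hH
    exact (directCorrelationStableTail_iff_twoPointLaw_gt_half_of_levyContinuity stub_levyContinuityTransfer hH).1 hT
  · intro h
    unfold PrecisionLaplacian.DirectCorrelationStableTail
    intro hH
    exact (directCorrelationStableTail_iff_twoPointLaw_gt_half_of_levyContinuity stub_levyContinuityTransfer hH).2
      (h hH) hH

/-- **Sufficient condition, outright.**  An isotropic pure power law of the critical two-point function with SOME exponent
`Δ > 1/2` implies the crux with no further hypothesis (NonSaturation is then automatic, and `H` is the crux's own antecedent). -/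
theorem DirectCorrelationStableTail_of_twoPointLaw_gt_half {Δ c : ℝ} (hΔ : 1 / 2 < Δ) (hc : 0 < c)
    (hT : Filter.Tendsto (fun x : Site 3 => criticalTwoPoint 3 x * Real.sqrt (∑ i, ((x i : ℝ)) ^ 2) ^ (2 * Δ))
      Filter.cofinite (nhds c)) :
    PrecisionLaplacian.DirectCorrelationStableTail :=
  directCorrelationStableTail_iff_symmPotential_imp_twoPointLaw_gt_half.2 fun _ => ⟨Δ, c, hΔ, hc, hT⟩

/-- **Necessary condition given saturation, outright in the crux.**  If `H` holds and the critical two-point function obeys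
the isotropic COULOMB law `G(x)|x|₂ → c > 0` (item 0634 with `Δ = 1/2`, i.e. saturation of the infrared bound), the crux FAILS. -/
theorem not_directCorrelationStableTail_of_symmPotential_of_coulomb
    (hH : ∀ A : Finset (Site 3), (Matrix.of fun (p q : ↥A) => criticalTwoPoint 3 (q.1 - p.1)).PosDef ∧
        ∀ u v : ↥A, (u ≠ v → (Matrix.of fun (p q : ↥A) => criticalTwoPoint 3 (q.1 - p.1))⁻¹ u v ≤ 0) ∧
          0 ≤ ∑ w, (Matrix.of fun (p q : ↥A) => criticalTwoPoint 3 (q.1 - p.1))⁻¹ u w)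
    {c : ℝ} (hc : 0 < c)
    (hT : Filter.Tendsto (fun x : Site 3 => criticalTwoPoint 3 x * Real.sqrt (∑ i, ((x i : ℝ)) ^ 2))
      Filter.cofinite (nhds c)) :
    ¬ PrecisionLaplacian.DirectCorrelationStableTail := by
  have hT' : Filter.Tendsto (fun x : Site 3 => criticalTwoPoint 3 x *
      Real.sqrt (∑ i, ((x i : ℝ)) ^ 2) ^ (2 * (1 / 2 : ℝ))) Filter.cofinite (nhds c) := by
    refine hT.congr fun x => ?_
    rw [show 2 * (1 / 2 : ℝ) = 1 by norm_num, Real.rpow_one]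
  exact (directCorrelationStableTail_decided_by_twoPointLaw_of_levyContinuity stub_levyContinuityTransfer hH hc hT').2
    le_rfl

/-- **Registered bookkeeping stub `stub_logicalMap`** (the hypothesis-free logical map, registered on the crux item verbatim):
crux ↔ (H → item 0634 ∧ item 1342). -/
theorem stub_logicalMap : Summit.CriticalPhenomena.Ising3DConformalLimit.Theses.PrecisionLaplacian.DirectCorrelationStableTail ↔ ((∀ A : Finset (Site 3), (Matrix.of fun (p q : ↥A) => criticalTwoPoint 3 (q.1 - p.1)).PosDef ∧ ∀ u v : ↥A, (u ≠ v → (Matrix.of fun (p q : ↥A) => criticalTwoPoint 3 (q.1 - p.1))⁻¹ u v ≤ 0) ∧ 0 ≤ ∑ w, (Matrix.of fun (p q : ↥A) => criticalTwoPoint 3 (q.1 - p.1))⁻¹ u w) → Summit.CriticalPhenomena.Ising3DConformalLimit.Theses.IsingEuclidUpgrade.IsingEuclidUpgradeR2RotInvPowerLaw ∧ Summit.CriticalPhenomena.Ising3DConformalLimit.Theses.PerfectScreening.NonSaturation) :=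
  directCorrelationStableTail_iff_symmPotential_imp

end Summit.CriticalPhenomena.Ising3DConformalLimit.Cruxes.DirectCorrelationStableTail.DiffusiveBranchIsNonsaturation

end
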